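import Literature.Probability.RandomPlanarGeometry.SLERestrictionMartingaleKappa
import HarnessLib

/-!
# The terminal value of the compensated restriction martingale ([LSW] Thm. 6.5): one-sided bounds and the `[0, ∞]`-valued form

Sequel to `SLERestrictionMartingaleKappa` (the specification `IsRestrictionMartingaleK κ α λ A L Y`
of the martingale `Y_t = h_t′(W_t)^α exp(λ ∫₀ᵗ Sh_s(W_s)/6 ds)` of [LSW] Prop. 5.3 and the
deduction of **Theorem 6.5**, "`Φ_A′(0)^α = E[1_{γ[0,∞) ∩ A = ∅} exp(λ ∫₀^∞ Sh_s(W_s)/6 ds)]`",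
from Lemmas 6.2 and 6.3), after G. F. Lawler, O. Schramm, W. Werner, *Conformal restriction: the
chordal case* (2003), §6.

The printed proof ("similar to that of Theorem 6.1") covers SMOOTH one-sided hulls (Lemma 6.3);
the passage to all of `𝒬*` needs, hull by hull, either the conclusion of Lemma 6.3 or a substitute
for it. This file isolates what Lemma 6.2 ALONE gives, in the `[0, ∞]`-valued form in which
Theorem 6.5 is consumed by §7.2 (`SLEBubbles.lintegral_poissonAvoidance_eq_rpow`):

* `thm65Fun κ λ A L` — the integrand `1_{T = ∞} · e^{−λ L_∞}` (`L_∞ = ⨆_t L_t`, `e^{−∞} = 0`) as an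
  `ℝ≥0∞`-valued function; `Yinf Y` — the limit of the martingale values along `ℕ`;
* `IsRestrictionMartingaleK.ae_tendsto_Yinf` — a.s. `Y_n → Yinf`, `= e^{−λ L_∞}` on `{T = ∞}`
  (Lemma 6.2) and `=` the frozen value on `{T < ∞}`; `integral_Yinf_eq` — `E[Yinf] = Φ_A′(0)^α`;
* **`lintegral_thm65Fun_le`** — the UPPER BOUND `∫⁻ 1_{T=∞} e^{−λ L_∞} ≤ Φ_A′(0)^α` from Lemma 6.2
  alone (`1_{T=∞} e^{−λ L_∞} ≤ Yinf`);
* **`ae_frozen_zero_of_lintegral_thm65Fun_eq`** — conversely, if equality holds then the martingale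
  vanishes from the hitting time on, a.s. on `{T < ∞}` (the substitute for Lemma 6.3 used for the
  side parts of a two-sided hull);
* **`lintegral_thm65Fun_eq_of_frozen_zero`**, **`lintegral_thm65Fun_eq_of_ltK`** — Theorem 6.5 for
  the hull in the `[0, ∞]`-valued form, from the vanishing of the frozen value (in particular from
  the conclusion of Lemma 6.3, `sle_restrictionDeriv_frequently_ltK`).

## References

* [LSW] Thm. 6.5 and the proofs of Thm. 6.1/6.5 (§6); §7.2 (pp. 28–29). [LawlerSchrammWerner2003Restriction]
-/

noncomputable section

open Set Filter Topology MeasureTheory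
open UpperHalfPlane (upperHalfPlaneSet)
open scoped NNReal ENNReal

namespace Literature.Probability.RandomPlanarGeometry

/-- **The integrand of [LSW] Thm. 6.5 in `[0, ∞]`-valued form**: `1_{T = ∞} · e^{−λ L_∞}`,
`L_∞ = ⨆_t L_t`, `e^{−∞} = 0`. [cite: LawlerSchrammWerner2003Restriction, Thm. 6.5 (§6) with §7.2] -/
def thm65Fun (κ : ℝ≥0) (lam : ℝ) (A : Set ℂ) (L : ℝ≥0 → (ℝ≥0 → ℝ) → ℝ≥0∞) (ω : ℝ≥0 → ℝ) : ℝ≥0∞ :=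
  {ω : ℝ≥0 → ℝ | firstHit (sleTrace κ ω) A = ⊤}.indicator
    (fun ω ↦ ENNReal.ofReal (compFactor (ENNReal.ofReal lam * ⨆ t, L t ω))) ω

/-- **The limit of the martingale values along `ℕ`** (a `limsup`, a genuine limit almost surely). [folklore] -/
def Yinf (Y : ℝ≥0 → (ℝ≥0 → ℝ) → ℝ) (ω : ℝ≥0 → ℝ) : ℝ := limsup (fun n : ℕ ↦ Y n ω) atTop

/-- On `{T = ∞}` the integrand is `e^{−λ L_∞}`. [folklore] -/
theorem thm65Fun_of_eq_top {κ : ℝ≥0} {lam : ℝ} {A : Set ℂ} {L : ℝ≥0 → (ℝ≥0 → ℝ) → ℝ≥0∞} {ω : ℝ≥0 → ℝ}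
    (h : firstHit (sleTrace κ ω) A = ⊤) :
    thm65Fun κ lam A L ω = ENNReal.ofReal (compFactor (ENNReal.ofReal lam * ⨆ t, L t ω)) := by
  rw [thm65Fun, indicator_of_mem (show ω ∈ {ω : ℝ≥0 → ℝ | firstHit (sleTrace κ ω) A = ⊤} from h)]

/-- On `{T < ∞}` the integrand is `0`. [folklore] -/
theorem thm65Fun_of_ne_top {κ : ℝ≥0} {lam : ℝ} {A : Set ℂ} {L : ℝ≥0 → (ℝ≥0 → ℝ) → ℝ≥0∞} {ω : ℝ≥0 → ℝ}
    (h : firstHit (sleTrace κ ω) A ≠ ⊤) : thm65Fun κ lam A L ω = 0 := by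
  rw [thm65Fun, indicator_of_notMem (show ω ∉ {ω : ℝ≥0 → ℝ | firstHit (sleTrace κ ω) A = ⊤} from h)]

/-- `thm65Fun ≤ 1`. [folklore] -/
theorem thm65Fun_le_one {κ : ℝ≥0} {lam : ℝ} {A : Set ℂ} {L : ℝ≥0 → (ℝ≥0 → ℝ) → ℝ≥0∞} (ω : ℝ≥0 → ℝ) :
    thm65Fun κ lam A L ω ≤ 1 := by
  by_cases h : firstHit (sleTrace κ ω) A = ⊤
  · rw [thm65Fun_of_eq_top h]
    exact ENNReal.ofReal_le_one.2 (compFactor_mem_Icc _).2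
  · rw [thm65Fun_of_ne_top h]; exact zero_le_one

section Limits

variable {κ : ℝ≥0} {α lam : ℝ} {A : Set ℂ} {L : ℝ≥0 → (ℝ≥0 → ℝ) → ℝ≥0∞} {Y : ℝ≥0 → (ℝ≥0 → ℝ) → ℝ}
  {Φ : ConformalEquiv (upperHalfPlaneSet \ A) upperHalfPlaneSet} {d : ℝ}

/-- **From the hitting time on, the martingale is constant** (all later values are the left limit at
`T`). [folklore] -/
theorem IsRestrictionMartingaleK.ae_frozen_const (hA : IsStarHull A) (hY : IsRestrictionMartingaleK κ α lam A L Y) :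
    ∀ᵐ ω ∂Process.preWienerMeasure, ∀ τ : ℝ≥0, firstHit (sleTrace κ ω) A = τ →
      ∀ t : ℝ≥0, τ ≤ t → Y t ω = Y τ ω := by
  filter_upwards [hY.ae_frozen] with ω hfrozen τ hτ t hτt
  have hτ0 : 0 < τ := by
    have h := firstHit_sleTrace_pos κ hA.isBoundedHull.isClosed hA.zero_notMem ω
    rw [hτ] at h
    exact_mod_cast h
  haveI : (𝓝[<] τ).NeBot := nhdsLT_neBot_of_exists_lt ⟨0, hτ0⟩
  exact tendsto_nhds_unique (hfrozen τ hτ t hτt) (hfrozen τ hτ τ le_rfl)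

/-- **A.s. the martingale values along `ℕ` converge to `Yinf`**, which is `e^{−λ L_∞}` on `{T = ∞}`
(Lemma 6.2) and the frozen value `Y_T` on `{T < ∞}`. [cite: LawlerSchrammWerner2003Restriction, proofs of Thm. 6.1/6.5 (§6)] -/
theorem IsRestrictionMartingaleK.ae_tendsto_Yinf (hα : 0 < α) (hA : IsStarHull A)
    (hY : IsRestrictionMartingaleK κ α lam A L Y) (h62 : sle_restrictionDeriv_frequently_gtK κ A) :
    ∀ᵐ ω ∂Process.preWienerMeasure, Tendsto (fun n : ℕ ↦ Y n ω) atTop (𝓝 (Yinf Y ω)) ∧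
      (firstHit (sleTrace κ ω) A = ⊤ → Yinf Y ω = compFactor (ENNReal.ofReal lam * ⨆ t, L t ω)) ∧
      ∀ τ : ℝ≥0, firstHit (sleTrace κ ω) A = τ → Yinf Y ω = Y τ ω := by
  filter_upwards [hY.ae_tendsto_compFactor hα h62, hY.ae_frozen_const hA] with ω htop hconst
  by_cases hT : firstHit (sleTrace κ ω) A = ⊤
  · have h1 : Tendsto (fun n : ℕ ↦ Y n ω) atTop (𝓝 (compFactor (ENNReal.ofReal lam * ⨆ t, L t ω))) :=
      (htop hT).comp tendsto_natCast_atTop_atTop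
    have h2 : Yinf Y ω = compFactor (ENNReal.ofReal lam * ⨆ t, L t ω) := h1.limsup_eq
    refine ⟨h2 ▸ h1, fun _ ↦ h2, fun τ hτ ↦ ?_⟩
    rw [hT] at hτ; exact absurd hτ WithTop.top_ne_coe
  · obtain ⟨τ, hτ⟩ := WithTop.ne_top_iff_exists.1 hT
    have hτ' : firstHit (sleTrace κ ω) A = τ := hτ.symm
    have hev : ∀ᶠ n : ℕ in atTop, Y n ω = Y τ ω := by
      obtain ⟨N, hN⟩ := exists_nat_ge (τ : ℝ)
      filter_upwards [eventually_ge_atTop N] with n hn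
      exact hconst τ hτ' n (by
        have : (τ : ℝ) ≤ n := hN.trans (by exact_mod_cast hn)
        exact_mod_cast this)
    have h1 : Tendsto (fun n : ℕ ↦ Y n ω) atTop (𝓝 (Y τ ω)) := tendsto_const_nhds.congr' (EventuallyEq.symm hev)
    have h2 : Yinf Y ω = Y τ ω := h1.limsup_eq
    refine ⟨h2 ▸ h1, fun h ↦ absurd h hT, fun τ' hτ'' ↦ ?_⟩
    have : τ' = τ := by
      have := hτ''.symm.trans hτ'
      exact_mod_cast this
    rw [this, h2]

/-- `Yinf` is measurable. [folklore] -/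
theorem IsRestrictionMartingaleK.measurable_Yinf (hY : IsRestrictionMartingaleK κ α lam A L Y) : Measurable (Yinf Y) :=
  Measurable.limsup fun n ↦ ((hY.martingale.1 n).mono (brownianFiltration.le _)).measurable

/-- `0 ≤ Yinf ≤ 1`. [folklore] -/
theorem IsRestrictionMartingaleK.Yinf_mem_Icc (hY : IsRestrictionMartingaleK κ α lam A L Y) (ω : ℝ≥0 → ℝ) :
    Yinf Y ω ∈ Icc (0 : ℝ) 1 := by
  rw [Yinf]
  have hb1 : ∀ n : ℕ, Y n ω ≤ 1 := fun n ↦ (hY.mem_Icc n ω).2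
  have hb0 : ∀ n : ℕ, 0 ≤ Y n ω := fun n ↦ (hY.mem_Icc n ω).1
  have hbdd : IsBoundedUnder (· ≤ ·) atTop fun n : ℕ ↦ Y n ω := ⟨1, eventually_map.2 (Eventually.of_forall hb1)⟩
  have hbddb : IsBoundedUnder (· ≥ ·) atTop fun n : ℕ ↦ Y n ω := ⟨0, eventually_map.2 (Eventually.of_forall hb0)⟩
  exact ⟨le_limsup_of_frequently_le (Frequently.of_forall hb0) hbdd,
    limsup_le_of_le hbddb.isCoboundedUnder_le (Eventually.of_forall hb1)⟩

/-- `Yinf` is integrable. [folklore] -/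
theorem IsRestrictionMartingaleK.integrable_Yinf (hY : IsRestrictionMartingaleK κ α lam A L Y) :
    Integrable (Yinf Y) Process.preWienerMeasure := by
  haveI := isProbabilityMeasure_preWienerMeasure'
  refine (integrable_const (1 : ℝ)).mono' hY.measurable_Yinf.aestronglyMeasurable (Eventually.of_forall fun ω ↦ ?_)
  rw [Real.norm_eq_abs, abs_of_nonneg (hY.Yinf_mem_Icc ω).1]; exact (hY.Yinf_mem_Icc ω).2

/-- **`E[Yinf] = Φ_A′(0)^α`** (dominated convergence, `E[Y_n] = Φ_A′(0)^α`). [cite: LawlerSchrammWerner2003Restriction, proofs of Thm. 6.1/6.5 (§6)] -/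
theorem IsRestrictionMartingaleK.integral_Yinf_eq (hα : 0 < α) (huniq : IsStarHull.existsUnique_isRestrictionMap)
    (hA : IsStarHull A) (hΦ : IsRestrictionMap A Φ) (hd : HasRestrictionDeriv A Φ d)
    (hY : IsRestrictionMartingaleK κ α lam A L Y) (h62 : sle_restrictionDeriv_frequently_gtK κ A) :
    ∫ ω, Yinf Y ω ∂Process.preWienerMeasure = d ^ α := by
  haveI := isProbabilityMeasure_preWienerMeasure'
  set P : Measure (ℝ≥0 → ℝ) := Process.preWienerMeasure with hP
  have hint : ∀ n : ℕ, ∫ ω, Y n ω ∂P = d ^ α := fun n ↦ hY.integral_eq huniq hA hΦ hd n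
  have hmeas : ∀ n : ℕ, AEStronglyMeasurable (Y n) P := fun n ↦ (hY.martingale.integrable _).aestronglyMeasurable
  have hlim : ∀ᵐ ω ∂P, Tendsto (fun n : ℕ ↦ Y n ω) atTop (𝓝 (Yinf Y ω)) := by
    filter_upwards [hY.ae_tendsto_Yinf hα hA h62] with ω hω
    exact hω.1
  have hbound : ∀ n : ℕ, ∀ᵐ ω ∂P, ‖Y n ω‖ ≤ (1 : ℝ) := fun n ↦
    Eventually.of_forall fun ω ↦ by
      rw [Real.norm_eq_abs, abs_le]
      have h := hY.mem_Icc n ω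
      exact ⟨by linarith [h.1], h.2⟩
  have hDCT := tendsto_integral_of_dominated_convergence (fun _ ↦ (1 : ℝ)) hmeas (integrable_const 1) hbound hlim
  refine tendsto_nhds_unique hDCT ?_
  simp_rw [hint]
  exact tendsto_const_nhds

/-- `∫⁻ ofReal Yinf = ofReal (Φ_A′(0)^α)`. [folklore] -/
theorem IsRestrictionMartingaleK.lintegral_ofReal_Yinf_eq (hα : 0 < α) (huniq : IsStarHull.existsUnique_isRestrictionMap)
    (hA : IsStarHull A) (hΦ : IsRestrictionMap A Φ) (hd : HasRestrictionDeriv A Φ d)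
    (hY : IsRestrictionMartingaleK κ α lam A L Y) (h62 : sle_restrictionDeriv_frequently_gtK κ A) :
    ∫⁻ ω, ENNReal.ofReal (Yinf Y ω) ∂Process.preWienerMeasure = ENNReal.ofReal (d ^ α) := by
  rw [← hY.integral_Yinf_eq hα huniq hA hΦ hd h62,
    ofReal_integral_eq_lintegral_ofReal hY.integrable_Yinf (Eventually.of_forall fun ω ↦ (hY.Yinf_mem_Icc ω).1)]

/-- `1_{T=∞} e^{−λ L_∞} ≤ Yinf` almost surely. [folklore] -/
theorem IsRestrictionMartingaleK.thm65Fun_ae_le_ofReal_Yinf (hα : 0 < α) (hA : IsStarHull A)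
    (hY : IsRestrictionMartingaleK κ α lam A L Y) (h62 : sle_restrictionDeriv_frequently_gtK κ A) :
    ∀ᵐ ω ∂Process.preWienerMeasure, thm65Fun κ lam A L ω ≤ ENNReal.ofReal (Yinf Y ω) := by
  filter_upwards [hY.ae_tendsto_Yinf hα hA h62] with ω hω
  by_cases hT : firstHit (sleTrace κ ω) A = ⊤
  · rw [thm65Fun_of_eq_top hT, hω.2.1 hT]
  · rw [thm65Fun_of_ne_top hT]; exact bot_le

/-- **The upper bound from Lemma 6.2 alone: `∫⁻ 1_{T=∞} e^{−λ L_∞} ≤ Φ_A′(0)^α`.**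
[cite: LawlerSchrammWerner2003Restriction, proofs of Thm. 6.1/6.5 (§6)] -/
theorem IsRestrictionMartingaleK.lintegral_thm65Fun_le (hα : 0 < α) (huniq : IsStarHull.existsUnique_isRestrictionMap)
    (hA : IsStarHull A) (hΦ : IsRestrictionMap A Φ) (hd : HasRestrictionDeriv A Φ d)
    (hY : IsRestrictionMartingaleK κ α lam A L Y) (h62 : sle_restrictionDeriv_frequently_gtK κ A) :
    ∫⁻ ω, thm65Fun κ lam A L ω ∂Process.preWienerMeasure ≤ ENNReal.ofReal (d ^ α) := by
  rw [← hY.lintegral_ofReal_Yinf_eq hα huniq hA hΦ hd h62]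
  exact lintegral_mono_ae (hY.thm65Fun_ae_le_ofReal_Yinf hα hA h62)

/-- **If Thm. 6.5 holds for `A` (in `[0, ∞]`-valued form), the martingale vanishes from the hitting
time on, a.s. on `{T < ∞}`** (`1_{T=∞} e^{−λ L_∞} ≤ Yinf` have equal finite integrals, hence agree
a.e.; on `{T < ∞}` the left side is `0` and the right side is the frozen value). This is the
substitute for Lemma 6.3 for the (non-smooth) side parts of a two-sided hull. [folklore] -/
theorem IsRestrictionMartingaleK.ae_frozen_zero_of_lintegral_thm65Fun_eq (hα : 0 < α)
    (huniq : IsStarHull.existsUnique_isRestrictionMap) (hA : IsStarHull A) (hΦ : IsRestrictionMap A Φ)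
    (hd : HasRestrictionDeriv A Φ d) (hY : IsRestrictionMartingaleK κ α lam A L Y)
    (h62 : sle_restrictionDeriv_frequently_gtK κ A)
    (heq : ∫⁻ ω, thm65Fun κ lam A L ω ∂Process.preWienerMeasure = ENNReal.ofReal (d ^ α)) :
    ∀ᵐ ω ∂Process.preWienerMeasure, ∀ τ : ℝ≥0, firstHit (sleTrace κ ω) A = τ → ∀ t : ℝ≥0, τ ≤ t → Y t ω = 0 := by
  have hle := hY.thm65Fun_ae_le_ofReal_Yinf hα hA h62
  have hg : AEMeasurable (fun ω ↦ ENNReal.ofReal (Yinf Y ω)) Process.preWienerMeasure :=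
    hY.measurable_Yinf.ennreal_ofReal.aemeasurable
  have hgf : ∫⁻ ω, ENNReal.ofReal (Yinf Y ω) ∂Process.preWienerMeasure ≤ ∫⁻ ω, thm65Fun κ lam A L ω ∂Process.preWienerMeasure := by
    rw [heq, hY.lintegral_ofReal_Yinf_eq hα huniq hA hΦ hd h62]
  have hae := ae_eq_of_ae_le_of_lintegral_le hle (by rw [heq]; exact ENNReal.ofReal_ne_top) hg hgf
  filter_upwards [hae, hY.ae_tendsto_Yinf hα hA h62, hY.ae_frozen_const hA] with ω hω hlim hconst τ hτ t hτt
  have hT : firstHit (sleTrace κ ω) A ≠ ⊤ := by rw [hτ]; exact WithTop.coe_ne_top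
  rw [thm65Fun_of_ne_top hT] at hω
  have h0 : Yinf Y ω ≤ 0 := ENNReal.ofReal_eq_zero.1 hω.symm
  have h1 : Yinf Y ω = Y τ ω := hlim.2.2 τ hτ
  have h2 : 0 ≤ Y τ ω := (hY.mem_Icc τ ω).1
  rw [hconst τ hτ t hτt]
  linarith

/-- **Thm. 6.5 for `A` in `[0, ∞]`-valued form, from the vanishing of the frozen value**: if the
martingale is `0` from the hitting time on (a.s. on `{T < ∞}`), then
`∫⁻ 1_{T=∞} e^{−λ L_∞} = Φ_A′(0)^α`. [cite: LawlerSchrammWerner2003Restriction, Thm. 6.5 and its proof (§6)] -/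
theorem IsRestrictionMartingaleK.lintegral_thm65Fun_eq_of_frozen_zero (hα : 0 < α)
    (huniq : IsStarHull.existsUnique_isRestrictionMap) (hA : IsStarHull A) (hΦ : IsRestrictionMap A Φ)
    (hd : HasRestrictionDeriv A Φ d) (hY : IsRestrictionMartingaleK κ α lam A L Y)
    (h62 : sle_restrictionDeriv_frequently_gtK κ A)
    (h0 : ∀ᵐ ω ∂Process.preWienerMeasure, ∀ τ : ℝ≥0, firstHit (sleTrace κ ω) A = τ → ∀ t : ℝ≥0, τ ≤ t → Y t ω = 0) :
    ∫⁻ ω, thm65Fun κ lam A L ω ∂Process.preWienerMeasure = ENNReal.ofReal (d ^ α) := by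
  rw [← hY.lintegral_ofReal_Yinf_eq hα huniq hA hΦ hd h62]
  refine lintegral_congr_ae ?_
  filter_upwards [hY.ae_tendsto_Yinf hα hA h62, h0] with ω hlim hzero
  by_cases hT : firstHit (sleTrace κ ω) A = ⊤
  · rw [thm65Fun_of_eq_top hT, hlim.2.1 hT]
  · obtain ⟨τ, hτ⟩ := WithTop.ne_top_iff_exists.1 hT
    rw [thm65Fun_of_ne_top hT, hlim.2.2 τ hτ.symm, hzero τ hτ.symm τ le_rfl, ENNReal.ofReal_zero]

/-- **Thm. 6.5 for `A` in `[0, ∞]`-valued form, from Lemmas 6.2 and 6.3** (the printed case: smooth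
one-sided hulls). [cite: LawlerSchrammWerner2003Restriction, Thm. 6.5 and its proof (§6)] -/
theorem IsRestrictionMartingaleK.lintegral_thm65Fun_eq_of_ltK (hα : 0 < α)
    (huniq : IsStarHull.existsUnique_isRestrictionMap) (hA : IsStarHull A) (hΦ : IsRestrictionMap A Φ)
    (hd : HasRestrictionDeriv A Φ d) (hY : IsRestrictionMartingaleK κ α lam A L Y)
    (h62 : sle_restrictionDeriv_frequently_gtK κ A) (h63 : sle_restrictionDeriv_frequently_ltK κ A) :
    ∫⁻ ω, thm65Fun κ lam A L ω ∂Process.preWienerMeasure = ENNReal.ofReal (d ^ α) :=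
  hY.lintegral_thm65Fun_eq_of_frozen_zero hα huniq hA hΦ hd h62 (hY.ae_eq_zero_of_le hα hA h63)

end Limits

end Literature.Probability.RandomPlanarGeometry

end
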